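import Summits.KontsevichZagierPeriods.KontsevichZagierPeriods.Theorems.KzOnePeriodsG2SFactorOvals

/-!
# G2S derivations, part 8: the factor relations of the `j = 1728` factor on explicit ovals

Sub-problem `KzOnePeriods` (Huber–Wüstholz [cite: HuberWustholz2022, Thm 13.3 (2) (p. 121)]).  kz1p's
G2-01 certificate (`C₆ : y² = (x² − 18)(x² − 24)(x² − 30)`, factor `E′₁ : Y² = X³ − 36X`, `j = 1728`)
consists of the reductions `∫_{c₁₂⁺} x dx/2y = ½·W₁(E′₁)`, `∫_{c₂₃⁺} x dx/2y = ½·W₂(E′₁)` (part 7,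
`relation_factorOval`) and the FACTOR relations `E1:CM-omega: W₂ − i·W₁ = 0`,
`E1:CM-eta: H₂ + i·H₁ = 0` between the symbols of `E′₁` over its two 2-torsion intervals.  This part
proves the factor relations on the explicit ovals of part 7:

* `relation_cmOvals` — on `E_{−e²,0} : Y² = X(X − e)(X + e)` the imaginary oval `δ₂ = (X₂, i·Y₂)` over
  `[0, e]` IS `[i] = (−X, iY)` applied to the real oval `δ₁ = (X₁, Y₁)` over `[−e, 0]` (both from
  `exists_weierOval`, based at the 2-torsion point `(0, 0)`, signs `ε`, `−ε`): `X₂ = −X₁`, `Y₂ = Y₁`;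
  hence (part E1-3, `cmI_derivations`: (R4) for the automorphism `[i]`, (R2) for `[i]^*θ₀ = iθ₀`,
  `[i]^*(Xθ₀) = −iXθ₀`, (R1)) `∫_{δ₂} θ₀ = i·∫_{δ₁} θ₀` and `∫_{δ₂} Xθ₀ = −i·∫_{δ₁} Xθ₀`.  The loops come
  with their formulas, end points (`(0, 0)`; `(∓e, 0)` at `t = ½`), ranges and sheets, ready for
  `relation_factorOval`.

No definitions, no new axioms, no statement of the programme cited.
-/

noncomputable section

open MvPolynomial Set Complex Filter Topology
open Literature.NumberTheory.Transcendental Literature.NumberTheory.Transcendental.CurvePeriods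
open Summit.KontsevichZagierPeriods.KzOnePeriods.E1Derivation

namespace Summit.KontsevichZagierPeriods.KzOnePeriods.G2SDerivation

/-- The period `∫_γ ω` of the symbol `(Z, ω, γ)`. -/
local notation3 (prettyPrint := false) "Pe[" Z ", " hZ ", " ω ", " h ", " γ "]" =>
  PeriodSymbol.period (⟨Z, hZ, ω, h, γ⟩ : PeriodSymbol)

/-- `x·θ₀`, the tree's polynomial representative of `X dX/Y` on `E_{A,B}`. -/
local notation3 (prettyPrint := false) "xθ₀[" A ", " B "]" =>
  ((X 0 : MvPolynomial (Fin 2) ℂ) • Weier.theta0 A B)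

/-! ### `j = 1728`: the imaginary oval is `[i]` of the real oval -/

/-- **kz1p's factor relations `W₂ = i·W₁`, `H₂ = −i·H₁` on explicit ovals.**  On
`E_{−e²,0} : Y² = X(X − e)(X + e)` (`e > 0` with `e²` algebraic; `j = 1728`) let `δ₁ = (X₁, Y₁)` be the
real oval over `[−e, 0]` and `δ₂ = (X₂, i·Y₂)` the imaginary oval over `[0, e]` of `exists_weierOval`,
both based at `(0, 0)`, with signs `ε` and `−ε`.  Then `X₂ = −X₁`, `Y₂ = Y₁`, i.e. `δ₂ = [i]∘δ₁` with
`[i] = (−X, iY)`, and `∫_{δ₂} θ₀ = i·∫_{δ₁} θ₀`, `∫_{δ₂} Xθ₀ = −i·∫_{δ₁} Xθ₀` (`cmI_derivations`). -/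
theorem relation_cmOvals {A : ℂ} {e ε : ℝ} (hA : A = ((-(e ^ 2) : ℝ) : ℂ)) (he : 0 < e)
    (hε : ε = 1 ∨ ε = -1) (hAa : IsAlgebraic ℚ A) (hA0 : A ≠ 0) :
    ∃ (X₁ Y₁ X₂ Y₂ : ℝ → ℝ) (δ₁ δ₂ : CurvePath (weierCurve A 0)),
      (∀ t, δ₁.toFun t = ![(X₁ t : ℂ), 1 * (Y₁ t : ℂ)]) ∧
      (∀ t, δ₂.toFun t = ![(X₂ t : ℂ), I * (Y₂ t : ℂ)]) ∧
      (∀ t, X₁ t = (0 + -e) / 2 + (0 - -e) / 2 * Real.cos (2 * Real.pi * t)) ∧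
      (∀ t, Y₁ t = ε * ((0 - -e) / 2) * Real.sin (2 * Real.pi * t) * √(-1 * (X₁ t - e))) ∧
      (∀ t, X₂ t = (0 + e) / 2 + (0 - e) / 2 * Real.cos (2 * Real.pi * t)) ∧
      (∀ t, Y₂ t = -ε * ((0 - e) / 2) * Real.sin (2 * Real.pi * t) * √(-(-1) * (X₂ t - -e))) ∧
      (∀ t, X₂ t = -X₁ t ∧ Y₂ t = Y₁ t) ∧
      ((X₁ 0 = 0 ∧ Y₁ 0 = 0) ∧ (X₁ 1 = 0 ∧ Y₁ 1 = 0) ∧ (X₁ (1 / 2) = -e ∧ Y₁ (1 / 2) = 0)) ∧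
      ((X₂ 0 = 0 ∧ Y₂ 0 = 0) ∧ (X₂ 1 = 0 ∧ Y₂ 1 = 0) ∧ (X₂ (1 / 2) = e ∧ Y₂ (1 / 2) = 0)) ∧
      (∀ t, X₁ t ∈ Icc (-e) 0) ∧ (∀ t, X₂ t ∈ Icc 0 e) ∧
      (∀ t ∈ Icc (0 : ℝ) 1, (t ≤ 1 / 2 → 0 ≤ ε * (e / 2) * Y₁ t) ∧
        (1 / 2 ≤ t → ε * (e / 2) * Y₁ t ≤ 0)) ∧
      (∀ t ∈ Icc (0 : ℝ) 1, (t ≤ 1 / 2 → 0 ≤ ε * (e / 2) * Y₂ t) ∧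
        (1 / 2 ≤ t → ε * (e / 2) * Y₂ t ≤ 0)) ∧
      Pe[weierCurve A 0, Weier.isSmoothAffineCurve A 0 hAa isAlgebraic_zero (disc_ne_zero_left hA0),
          Weier.theta0 A 0, Weier.hasAlgCoeffs_theta0 A 0 hAa isAlgebraic_zero, δ₂] =
        I * Pe[weierCurve A 0, Weier.isSmoothAffineCurve A 0 hAa isAlgebraic_zero
          (disc_ne_zero_left hA0), Weier.theta0 A 0, Weier.hasAlgCoeffs_theta0 A 0 hAa
          isAlgebraic_zero, δ₁] ∧
      Pe[weierCurve A 0, Weier.isSmoothAffineCurve A 0 hAa isAlgebraic_zero (disc_ne_zero_left hA0),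
          xθ₀[A, 0], Weier.hasAlgCoeffs_smul_theta0 A 0 hAa isAlgebraic_zero (hasAlgCoeffs_X 0), δ₂] =
        -I * Pe[weierCurve A 0, Weier.isSmoothAffineCurve A 0 hAa isAlgebraic_zero
          (disc_ne_zero_left hA0), xθ₀[A, 0], Weier.hasAlgCoeffs_smul_theta0 A 0 hAa
          isAlgebraic_zero (hasAlgCoeffs_X 0), δ₁] := by
  have hfac₁ : ∀ X : ℝ, X ^ 3 + -(e ^ 2) * X + 0 = (X - 0) * (X - -e) * (X - e) := fun X => by ring
  have hfac₂ : ∀ X : ℝ, X ^ 3 + -(e ^ 2) * X + 0 = (X - 0) * (X - e) * (X - -e) := fun X => by ring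
  have h0alg : IsAlgebraic ℚ ((0 : ℝ) : ℂ) := by simpa using (isAlgebraic_zero : IsAlgebraic ℚ (0 : ℂ))
  have hB0 : (0 : ℂ) = ((0 : ℝ) : ℂ) := by simp
  have hε' : -ε = 1 ∨ -ε = -1 := by rcases hε with rfl | rfl <;> norm_num
  have hL₁ : ∀ X ∈ uIcc (0 : ℝ) (-e), 0 < -(1 : ℝ) * (X - e) := fun X hX => by
    rw [uIcc_of_ge (by linarith)] at hX
    nlinarith [hX.2]
  have hL₂ : ∀ X ∈ uIcc (0 : ℝ) e, 0 < -(-1 : ℝ) * (X - -e) := fun X hX => by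
    rw [uIcc_of_le he.le] at hX
    nlinarith [hX.1]
  obtain ⟨X₁, Y₁, δ₁, -, -, hδ₁, hX₁, hY₁, h10, h11, h1h, hb₁, -, hs₁⟩ :=
    exists_weierOval (η := 1) (σ := 1) hA hB0 hfac₁ (Or.inl rfl) (by norm_num) hε hL₁ h0alg
  obtain ⟨X₂, Y₂, δ₂, -, -, hδ₂, hX₂, hY₂, h20, h21, h2h, hb₂, -, hs₂⟩ :=
    exists_weierOval (η := I) (σ := -1) hA hB0 hfac₂ (Or.inr rfl) (by norm_num [I_sq]) hε' hL₂ h0alg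
  have hXX : ∀ t, X₂ t = -X₁ t := fun t => by rw [hX₁, hX₂]; ring
  have hYY : ∀ t, Y₂ t = Y₁ t := fun t => by
    rw [hY₁, hY₂]
    have : -(-1 : ℝ) * (X₂ t - -e) = -1 * (X₁ t - e) := by rw [hXX]; ring
    rw [this]
    ring
  have hcm : ∀ t ∈ Icc (0 : ℝ) 1, δ₂.toFun t = ![-δ₁.toFun t 0, I * δ₁.toFun t 1] := fun t _ => by
    rw [hδ₂, hδ₁]
    simp only [Matrix.cons_val_zero, Matrix.cons_val_one, one_mul]
    rw [hXX, hYY, ofReal_neg]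
  have key := cmI_derivations (A := A) I_sq
    (Weier.isSmoothAffineCurve A 0 hAa isAlgebraic_zero (disc_ne_zero_left hA0))
    (Weier.hasAlgCoeffs_theta0 A 0 hAa isAlgebraic_zero)
    (Weier.hasAlgCoeffs_smul_theta0 A 0 hAa isAlgebraic_zero (hasAlgCoeffs_X 0)) hcm
  refine ⟨X₁, Y₁, X₂, Y₂, δ₁, δ₂, hδ₁, hδ₂, hX₁, hY₁, hX₂, hY₂, fun t => ⟨hXX t, hYY t⟩,
    ⟨h10, h11, h1h⟩, ⟨h20, h21, h2h⟩, fun t => ?_, fun t => ?_, fun t ht => ?_, fun t ht => ?_,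
    key.1.2, key.2.2⟩
  · have := hb₁ t
    rwa [uIcc_of_ge (by linarith)] at this
  · have := hb₂ t
    rwa [uIcc_of_le he.le] at this
  · have hk : ε * ((0 - -e) / 2) = ε * (e / 2) := by ring
    have := hs₁ t ht
    rwa [hk] at this
  · have hk : -ε * ((0 - e) / 2) = ε * (e / 2) := by ring
    have := hs₂ t ht
    rwa [hk] at this

end Summit.KontsevichZagierPeriods.KzOnePeriods.G2SDerivation

end
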